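import Mathlib.RingTheory.Bialgebra.Basic
import Mathlib.LinearAlgebra.TensorProduct.Associator
import HarnessLib

/-!
# A left integral is invariant under Habiro's handle-slide operator

For a bialgebra `A` over a commutative ring `R`, Habiro's **slide operator** is
`h = (μ ⊗ 1) ∘ (1 ⊗ Δ) : A ⊗ A → A ⊗ A`, `x ⊗ y ↦ ∑ x y₍₁₎ ⊗ y₍₂₎` (Habiro, *Bottom tangles and universal
invariants*, Algebr. Geom. Topol. 6 (2006), §12: the operator `h_H` of a Hopf algebra in the symmetric monoidal
category of `R`-modules; for the transmutation of a ribbon Hopf algebra the same formula with the transmuted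
coproduct is the algebraic form of a 2-handle slide, Thm. 12.1). If `χ : A →ₗ[R] R` is a **left integral on
`A`**, i.e. `(1 ⊗ χ) ∘ Δ = η ∘ χ`, then the functional `χ ⊗ χ` (multiplied into `R`) is `h`-invariant:
`(χ ⊗ χ)(∑ x y₍₁₎ ⊗ y₍₂₎) = χ(x) χ(y)`. This is the computation in the proof of Habiro's Prop. 15 (the
Hennings 3-manifold invariant), here for an arbitrary bialgebra (no antipode, `R`-matrix or ribbon element is
used). Fully proved (`leftIntegral_slideInvariant_holds`).

Contents: `slideOp`, `pair₂` (the functional `x ⊗ y ↦ χ x * χ y`), the fact `leftIntegral_slideInvariant` and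
its proof. Not here: the transmuted coproduct, Habiro's Lemma 9 (for an `ad`-invariant `φ`,
`(1 ⊗ φ) Δ̲ = (1 ⊗ φ) Δ`), or the Hennings invariant itself.
-/

namespace Literature.RingTheory.HopfActions

open TensorProduct

/-- Habiro's slide operator `h = (μ ⊗ 1) ∘ (1 ⊗ Δ) : A ⊗ A → A ⊗ A`, `x ⊗ y ↦ ∑ x y₍₁₎ ⊗ y₍₂₎`
(AGT 6 (2006) §12, the operator `h_H` in the symmetric monoidal category of `R`-modules).
[cite: Habiro2006BottomTangles, §12] -/
noncomputable def slideOp (R A : Type*) [CommRing R] [Ring A] [Bialgebra R A] :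
    A ⊗[R] A →ₗ[R] A ⊗[R] A :=
  (LinearMap.rTensor A (LinearMap.mul' R A)) ∘ₗ (TensorProduct.assoc R A A A).symm.toLinearMap ∘ₗ
    (LinearMap.lTensor A Coalgebra.comul)

/-- The functional `χ ⊗ χ` on `A ⊗ A`, multiplied into `R`: `x ⊗ y ↦ χ x * χ y`. [folklore] -/
noncomputable def pair₂ (R A : Type*) [CommRing R] [Ring A] [Bialgebra R A] (χ : A →ₗ[R] R) :
    A ⊗[R] A →ₗ[R] R :=
  LinearMap.mul' R R ∘ₗ TensorProduct.map χ χ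

/-- **Slide invariance of a left integral** (Habiro 2006, Prop. 15; the algebraic core of the
Hennings invariant). If `χ : A →ₗ[R] R` is a left integral on the
bialgebra `A`, i.e. `(1 ⊗ χ) ∘ Δ = η ∘ χ` (stated in `A ⊗[R] R` via `TensorProduct.rid`), then `χ ⊗ χ` is
invariant under the slide operator: `pair₂ χ ∘ slideOp = pair₂ χ`. Habiro (2006), Prop. 15.
[cite: Habiro2006BottomTangles, Prop. 15] -/
def leftIntegral_slideInvariant (R A : Type*) [CommRing R] [Ring A] [Bialgebra R A] : Prop :=
  ∀ (χ : A →ₗ[R] R),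
    (LinearMap.lTensor A χ ∘ₗ Coalgebra.comul =
        (TensorProduct.rid R A).symm.toLinearMap ∘ₗ Algebra.linearMap R A ∘ₗ χ) →
      pair₂ R A χ ∘ₗ slideOp R A = pair₂ R A χ

/-- Pointwise computation of `pair₂ χ ∘ slideOp` on `x ⊗ t` for an arbitrary tensor `t : A ⊗ A`
(to be applied with `t = Δ y`): it equals `χ (x * ρ((1 ⊗ χ) t))`, where `ρ : A ⊗ R ≃ A` is the
right unitor `TensorProduct.rid`. [folklore] -/
theorem pair₂_slide_tmul_aux (R A : Type*) [CommRing R] [Ring A] [Bialgebra R A]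
    (χ : A →ₗ[R] R) (x : A) (t : A ⊗[R] A) :
    LinearMap.mul' R R (TensorProduct.map χ χ (LinearMap.rTensor A (LinearMap.mul' R A)
      ((TensorProduct.assoc R A A A).symm (x ⊗ₜ[R] t)))) =
      χ (x * TensorProduct.rid R A (LinearMap.lTensor A χ t)) := by
  induction t with
  | zero => simp only [tmul_zero, map_zero, mul_zero]
  | tmul a b =>
    simp only [TensorProduct.assoc_symm_tmul, LinearMap.rTensor_tmul, LinearMap.mul'_apply,
      TensorProduct.map_tmul, LinearMap.lTensor_tmul, TensorProduct.rid_tmul, mul_smul_comm,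
      map_smul, smul_eq_mul, mul_comm]
  | add s t hs ht => simp only [tmul_add, map_add, hs, ht, mul_add]

/-- Proof of `leftIntegral_slideInvariant` (a direct computation with a Sweedler-free
induction on the tensor `Δ y`). [cite: Habiro2006BottomTangles, Prop. 15] -/
theorem leftIntegral_slideInvariant_holds (R A : Type*) [CommRing R] [Ring A] [Bialgebra R A] :
    leftIntegral_slideInvariant R A := by
  intro χ hχ
  refine TensorProduct.ext' fun x y => ?_
  have hy : LinearMap.lTensor A χ (Coalgebra.comul y) = (algebraMap R A (χ y)) ⊗ₜ[R] (1 : R) := by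
    have := LinearMap.congr_fun hχ y
    simpa only [LinearMap.comp_apply, LinearEquiv.coe_coe, Algebra.linearMap_apply,
      TensorProduct.rid_symm_apply] using this
  simp only [pair₂, slideOp, LinearMap.comp_apply, LinearMap.lTensor_tmul, LinearEquiv.coe_coe,
    TensorProduct.map_tmul, LinearMap.mul'_apply]
  rw [pair₂_slide_tmul_aux, hy, TensorProduct.rid_tmul, one_smul, ← Algebra.commutes,
    ← Algebra.smul_def, map_smul, smul_eq_mul, mul_comm]

end Literature.RingTheory.HopfActions
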